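import Literature.Topology.FourManifolds.PLManifold
import HarnessLib

/-!
# Uniqueness of Whitehead-compatible PL structures: the final glue

Towards `Literature.Topology.FourManifolds.nonempty_plHomeomorph_of_isWhiteheadCompatible`
(Munkres, *Elementary differential topology* (1966), Thm 10.5; Whitehead (1940), Thm 8).
The proof in this library does not follow Munkres' bookkeeping of two global triangulations;
instead it perturbs two homeomorphisms `F, G` of `M` (initially the identity), keeping `F`
*piecewise differentiable along* the first PL structure and `G` along the second, until
`F⁻¹ ∘ G` is PL from the second PL structure to the first on all of `M`.  This file fixes the
two bookkeeping predicates and proves the two ends of that argument: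

* `PDAlong n cPL cDIFF F` — in the charts of `cPL` (source) and `cDIFF` (target) the
  homeomorphism `F` is piecewise differentiable of maximal rank (`IsPDOn`); for `F = id` this is
  literally `IsWhiteheadCompatible n M cPL cDIFF` (`pdAlong_refl_iff`): the start of the
  induction;
* `PLAlongOn n c c' h W` — in the charts of `c` (source) and `c'` (target) the homeomorphism `h`
  is PL (`IsPLOn`) over the set `W`; it is antitone in `W` and local;
* `nonempty_structomorph_of_plAlongOn` — if `h` is PL along `(c₁, c₂)` on all of `M` and `h.symm`
  is PL along `(c₂, c₁)` on all of `M`, then `h` is a `Structomorph` for `plGroupoid n`: the end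
  of the induction.

No named facts are introduced (`PDAlong`, `PLAlongOn` are `Prop`-valued bookkeeping structures).

## References

* J.R. Munkres, *Elementary differential topology*, Ann. of Math. Studies 54 (1963; rev. 1966),
  §10, Thm 10.5. [Munkres1966]
* J.H.C. Whitehead, *On C¹-complexes*, Ann. of Math. 41 (1940), Thm 8. [Whitehead1940]
-/

open scoped Manifold Topology
open Set Function

noncomputable section

namespace Literature.Topology.FourManifolds

local notation "𝔼 " n:arg => EuclideanSpace ℝ (Fin n)

section Predicates

variable (n : ℕ) {M : Type*} [TopologicalSpace M]

/-- **`F` is piecewise differentiable along `(cPL, cDIFF)`**: for every chart `e` of `cPL` and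
every chart `e'` of `cDIFF` the map `e' ∘ F ∘ e.symm` is piecewise differentiable of maximal
rank on its natural domain `e.target ∩ e.symm ⁻¹' (F ⁻¹' e'.source)`.  For `F = id` this is
Whitehead compatibility (`pdAlong_refl_iff`). (A `Prop`-valued bookkeeping structure, not a
named fact.) [cite: Munkres1966, §8 and Thm 10.5] -/
structure PDAlong (cPL cDIFF : ChartedSpace (𝔼 n) M) (F : M ≃ₜ M) : Prop where
  /-- the chart-level condition -/
  isPDOn : ∀ e ∈ @atlas (𝔼 n) _ M _ cPL, ∀ e' ∈ @atlas (𝔼 n) _ M _ cDIFF,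
    IsPDOn n (e' ∘ F ∘ e.symm) (e.target ∩ e.symm ⁻¹' (F ⁻¹' e'.source))

/-- **`h` is PL along `(c, c')` over `W`**: for every chart `e` of `c` and every chart `e'` of
`c'` the map `e' ∘ h ∘ e.symm` is PL on `e.target ∩ e.symm ⁻¹' (W ∩ h ⁻¹' e'.source)`, the part
of the natural domain lying over `W`. (A `Prop`-valued bookkeeping structure, not a named fact.)
[cite: Munkres1966, Thm 10.5] -/
structure PLAlongOn (c c' : ChartedSpace (𝔼 n) M) (h : M ≃ₜ M) (W : Set M) : Prop where
  /-- the chart-level condition -/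
  isPLOn : ∀ e ∈ @atlas (𝔼 n) _ M _ c, ∀ e' ∈ @atlas (𝔼 n) _ M _ c',
    IsPLOn n n (e' ∘ h ∘ e.symm) (e.target ∩ e.symm ⁻¹' (W ∩ h ⁻¹' e'.source))

variable {n}

/-- For the identity, `PDAlong` is Whitehead compatibility. [cite: Munkres1966, §8] -/
theorem pdAlong_refl_iff {cPL cDIFF : ChartedSpace (𝔼 n) M} :
    PDAlong n cPL cDIFF (Homeomorph.refl M) ↔ IsWhiteheadCompatible n M cPL cDIFF := by
  constructor
  · intro h e he e' he'
    have h1 := h.isPDOn e he e' he'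
    have hs : (e.symm.trans e').source = e.target ∩ e.symm ⁻¹' ((Homeomorph.refl M) ⁻¹' e'.source) := by
      rw [OpenPartialHomeomorph.trans_source, OpenPartialHomeomorph.symm_source]
      rfl
    rw [hs]
    exact h1
  · intro h
    refine ⟨fun e he e' he' => ?_⟩
    have h1 := h e he e' he'
    have hs : (e.symm.trans e').source = e.target ∩ e.symm ⁻¹' ((Homeomorph.refl M) ⁻¹' e'.source) := by
      rw [OpenPartialHomeomorph.trans_source, OpenPartialHomeomorph.symm_source]
      rfl
    rw [hs] at h1
    exact h1

/-- `PLAlongOn` is antitone in the set. [folklore] -/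
theorem PLAlongOn.anti {c c' : ChartedSpace (𝔼 n) M} {h : M ≃ₜ M} {W W' : Set M}
    (hW : PLAlongOn n c c' h W) (hW'o : IsOpen W') (hsub : W' ⊆ W)
    (hmono : IsPLOn.mono (n := n) (m := n)) : PLAlongOn n c c' h W' := by
  refine ⟨fun e he e' he' => ?_⟩
  have h1 := hW.isPLOn e he e' he'
  refine hmono h1 ?_ ?_
  · have h2 := e.symm.isOpen_inter_preimage (hW'o.inter (e'.open_source.preimage h.continuous))
    rwa [OpenPartialHomeomorph.symm_source] at h2
  · exact inter_subset_inter_right _ (preimage_mono (inter_subset_inter_left _ hsub))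

/-- `PLAlongOn` on the empty set. [folklore] -/
theorem plAlongOn_empty {c c' : ChartedSpace (𝔼 n) M} {h : M ≃ₜ M} : PLAlongOn n c c' h ∅ :=
  ⟨fun e _ e' _ => by simp only [empty_inter, preimage_empty, inter_empty]; exact fun a ha => ha.elim⟩

/-- `PLAlongOn` is local: it holds on a union of sets as soon as it holds on each (the
definition of `IsPLOn` is pointwise). [folklore] -/
theorem plAlongOn_iUnion {ι : Type*} {c c' : ChartedSpace (𝔼 n) M} {h : M ≃ₜ M} {W : ι → Set M}
    (hW : ∀ i, PLAlongOn n c c' h (W i)) :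
    PLAlongOn n c c' h (⋃ i, W i) := by
  refine ⟨fun e he e' he' => ?_⟩
  refine IsPLOn.of_forall_exists fun a ha => ?_
  obtain ⟨hat, haW, hae'⟩ := ha
  obtain ⟨i, hi⟩ := mem_iUnion.1 haW
  refine ⟨e.target ∩ e.symm ⁻¹' (W i ∩ h ⁻¹' e'.source), ?_, ⟨hat, hi, hae'⟩, (hW i).isPLOn e he e' he'⟩
  exact inter_subset_inter_right _ (preimage_mono (inter_subset_inter_left _ (subset_iUnion W i)))

end Predicates

/-! ### The final glue -/

section Glue

variable (n : ℕ) (hcomp : IsPLOn.comp (n := n)) (haff : isPLOn_affineMap (n := n) (m := n))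
variable {M : Type*} [TopologicalSpace M]

/-- **End of the induction.** A homeomorphism `h` of `M` which is PL along `(c₁, c₂)` on all of
`M`, with inverse PL along `(c₂, c₁)` on all of `M`, is a PL homeomorphism `(M, c₁) → (M, c₂)`,
i.e. a `Structomorph` for `plGroupoid n` (membership in the PL groupoid is PL-ness of the map on
its source and of its inverse on its target, `mem_plGroupoid_iff`). [cite: Munkres1966, Thm 10.5] -/
theorem nonempty_structomorph_of_plAlongOn {c₁ c₂ : ChartedSpace (𝔼 n) M} (h : M ≃ₜ M)
    (h₁₂ : PLAlongOn n c₁ c₂ h univ) (h₂₁ : PLAlongOn n c₂ c₁ h.symm univ) :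
    Nonempty (@Structomorph (𝔼 n) _ (plGroupoid n hcomp haff) M M _ _ c₁ c₂) := by
  refine ⟨@Structomorph.mk (𝔼 n) _ (plGroupoid n hcomp haff) M M _ _ c₁ c₂ h fun c c' hc hc' => ?_⟩
  rw [mem_plGroupoid_iff]
  constructor
  · -- the map itself
    have h1 := h₁₂.isPLOn c hc c' hc'
    have hs : (c.symm ≫ₕ h.toOpenPartialHomeomorph ≫ₕ c').source =
        c.target ∩ c.symm ⁻¹' (univ ∩ h ⁻¹' c'.source) := by
      simp only [OpenPartialHomeomorph.trans_source, OpenPartialHomeomorph.symm_source,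
        Homeomorph.toOpenPartialHomeomorph_source, univ_inter]
      rfl
    rw [hs]
    exact h1
  · -- its inverse
    have h1 := h₂₁.isPLOn c' hc' c hc
    have hs : (c.symm ≫ₕ h.toOpenPartialHomeomorph ≫ₕ c').target =
        c'.target ∩ c'.symm ⁻¹' (univ ∩ h.symm ⁻¹' c.source) := by
      rw [← OpenPartialHomeomorph.symm_source, OpenPartialHomeomorph.trans_symm_eq_symm_trans_symm,
        OpenPartialHomeomorph.trans_symm_eq_symm_trans_symm, OpenPartialHomeomorph.symm_symm]
      ext x
      simp only [OpenPartialHomeomorph.trans_source, OpenPartialHomeomorph.symm_source,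
        Homeomorph.toOpenPartialHomeomorph_target, univ_inter, mem_inter_iff, mem_preimage, mem_univ,
        and_true, OpenPartialHomeomorph.coe_trans, Function.comp_apply, and_congr_right_iff]
      intro _
      rfl
    rw [hs]
    have hfun : ((c.symm ≫ₕ h.toOpenPartialHomeomorph ≫ₕ c').symm : 𝔼 n → 𝔼 n) =
        c ∘ h.symm ∘ c'.symm := by
      rw [OpenPartialHomeomorph.trans_symm_eq_symm_trans_symm,
        OpenPartialHomeomorph.trans_symm_eq_symm_trans_symm, OpenPartialHomeomorph.symm_symm]
      rfl
    rw [hfun]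
    exact h1

end Glue

end Literature.Topology.FourManifolds
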